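import Summits.ValiantsHypothesis.ValiantsHypothesis.Theorems.LacunarySymmetroidMatrixDescartesCensusDoorA34KernelPlanes

/-!
# `MatrixDescartes` census — DOOR A at `(3,4)`: the TRANSVERSALITY LAW — at a simple det-root of a real symmetric `3 × 3` lacunary pencil the
# kernel's Rayleigh fewnomial has a SIMPLE root (so every plane through the kernel is indefinite on the far side)

HONEST FRAMING.  Object-search cell `pub-symmetroid`, door-A seat `val-sym-door-p3` (g24); helper file `--supports` the OPEN typed statement
`Theses.LacunarySymmetroid.DoorA34 = PosRootLawAt 3 4 18` (stmt-ValiantsHypothesis-19980), asserted nowhere here.  WHY.  The located mechanism behind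
the one-branch ceiling `OB(3,3) = 7` of the flag ladder's source question (Claim L on `d₂ < 2d₁`, seat report DOOR-A34-P3G24-REPORT §4b) is the
PAIR-PLANE DESCARTES BUDGET: a plane through two kernels `k_i, k_j` of a pure-λ_min configuration carries FOUR forced PSD-singular points of the
compressed `(2,3)` row — each kernel crossing is TRANSVERSAL and forces a partner zero in the adjacent negativity window — and the tree's
seven-point alternation law (`Census.no_seven_alternation_compress`) then forbids any further dip.  The alternation law is kernel; the
transversality step was paper.  THIS file proves it for EVERY real symmetric `3 × 3` lacunary pencil `P(x) = ∑ x^{d l} S_l` (any number of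
letters, any exponents), purely algebraically (no derivatives):

* `det_add_smul_three` — `det(M + t N) = det M + t·tr(adj M·N) + t²·tr(adj N·M) + t³·det N` (`3 × 3`, any commutative ring);
* `pencil_split` — the Taylor split `P(X) = P(r) + (X − r)·G(X)` over `ℝ[X]` (entrywise `divByMonic`); `det_pencil_split`, `eval_H` —
  at a det-root `det P = (X − r)·H` with `H(r) = tr(adj P(r)·G(r))` (Jacobi's formula, first order);
* `trace_adjugate_mul_ne_zero_of_simple` — `(X − r)² ∤ det P ⇒ tr(adj P(r)·G(r)) ≠ 0`; `quadForm_ne_zero_of_trace_adjugate_mul_ne_zero` —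
  with `P(r)k = 0`, `k ≠ 0` (kernel form `|k|²·adj = tr(adj)·kkᵀ`, `…KernelPlanes.adjugate_smul_eq_of_mulVec_eq_zero`): `kᵀG(r)k ≠ 0`;
* `rayleigh_split`, `eval_rayleigh` — the Rayleigh polynomial `kᵀP(X)k = (X − r)·kᵀG(X)k`;
* **`rayleigh_sign_change`** — THE TRANSVERSALITY LAW: at a simple det-root `r` with kernel `k`, `kᵀP(x)k · kᵀP(y)k < 0` for
  `r − δ < x < r < y < r + δ`; **`rayleigh_neg_left_of_pos_right`** / **`rayleigh_neg_right_of_pos_left`** — if `P ≻ 0` (or merely `kᵀPk > 0`)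
  on one side of `r`, then `kᵀP k < 0` on the other side near `r`: every plane through `k` is INDEFINITE there, which is the negative witness
  the alternation laws (`…PlaneCompression`, `…RootWitness`, `…EndLetter`) take as a hypothesis.

Nothing here bounds `ζ_sym(3,3)` or `ζ_sym(3,4)`; `DoorA34`, Claim L on `d₂ < 2d₁` and `MatrixDescartes` (stmt-ValiantsHypothesis-18050) stay OPEN;
nothing on `VP ≠ VNP`.  [folklore] Jacobi's formula for the derivative of a determinant in algebraic dress; elementary.
-/

set_option linter.dupNamespace false

namespace Summit.ValiantsHypothesis.ValiantsHypothesis.Theorems.LacunarySymmetroidMatrixDescartes.Census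

namespace Transversal

open Polynomial Finset Matrix
open scoped BigOperators Polynomial Matrix

/-! ## 1. The cubic expansion of a 3 × 3 determinant -/

/-- `det (M + t•N) = det M + t·tr(adj M · N) + t²·tr(adj N · M) + t³·det N` for `3 × 3` matrices over a commutative ring. [folklore] -/
theorem det_add_smul_three {R : Type*} [CommRing R] (M N : Matrix (Fin 3) (Fin 3) R) (t : R) :
    (M + t • N).det = M.det + t * (M.adjugate * N).trace + t ^ 2 * (N.adjugate * M).trace + t ^ 3 * N.det := by
  simp only [Matrix.det_fin_three, Matrix.adjugate_fin_three, Matrix.trace, Matrix.diag, Matrix.mul_apply, Matrix.add_apply,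
    Matrix.smul_apply, smul_eq_mul, Fin.sum_univ_three, Matrix.of_apply, Matrix.cons_val', Matrix.cons_val_zero, Matrix.cons_val_one,
    Matrix.cons_val_two, Matrix.vecHead, Matrix.vecTail, Function.comp_apply, Fin.succ_zero_eq_one,
    Matrix.empty_val', Matrix.cons_val_fin_one]
  ring

/-! ## 2. Taylor split of a lacunary pencil at a point -/

variable {K : ℕ}

/-- Entries of the pencil evaluate to the entries of the evaluated pencil. [folklore] -/
theorem eval_pencil_apply (d : Fin K → ℕ) (S : Fin K → Matrix (Fin 3) (Fin 3) ℝ) (r : ℝ) (i j : Fin 3) :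
    ((∑ l, ((X : ℝ[X]) ^ d l) • (S l).map C) i j).eval r = (∑ l, r ^ d l • S l) i j := by
  simp only [Matrix.sum_apply, Matrix.smul_apply, Matrix.map_apply, smul_eq_mul, eval_finsetSum, eval_mul, eval_pow, eval_X, eval_C]

/-- The evaluation map on polynomial matrices is evaluation of the pencil. [folklore] -/
theorem mapMatrix_eval_pencil (d : Fin K → ℕ) (S : Fin K → Matrix (Fin 3) (Fin 3) ℝ) (r : ℝ) :
    (evalRingHom r).mapMatrix (∑ l, ((X : ℝ[X]) ^ d l) • (S l).map C) = ∑ l, r ^ d l • S l := by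
  ext i j
  rw [RingHom.mapMatrix_apply, Matrix.map_apply, coe_evalRingHom, eval_pencil_apply]

/-- **Taylor split.**  `P(X) = A + (X − r)·G(X)` with `A = P(r)` and `G` the entrywise quotient. [folklore] -/
theorem pencil_split (d : Fin K → ℕ) (S : Fin K → Matrix (Fin 3) (Fin 3) ℝ) (r : ℝ) :
    (∑ l, ((X : ℝ[X]) ^ d l) • (S l).map C)
      = (∑ l, r ^ d l • S l).map C
        + (X - C r) • Matrix.of (fun i j => (((∑ l, ((X : ℝ[X]) ^ d l) • (S l).map C) i j - C ((∑ l, r ^ d l • S l) i j)) /ₘ (X - C r))) := by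
  ext i j
  rw [Matrix.add_apply, Matrix.smul_apply, Matrix.of_apply, Matrix.map_apply, smul_eq_mul]
  have hroot : IsRoot ((∑ l, ((X : ℝ[X]) ^ d l) • (S l).map C) i j - C ((∑ l, r ^ d l • S l) i j)) r := by
    rw [IsRoot.def, eval_sub, eval_C, eval_pencil_apply, sub_self]
  have h := (mul_divByMonic_eq_iff_isRoot).mpr hroot
  rw [h]; abel

/-! ## 3. The determinant near a root: `det P = (X − r)·H` with `H(r) = tr(adj A · G(r))` -/

/-- **First-order expansion of the determinant at a det-root.**  If `det A = 0` (`A = P(r)`) then `det P = (X − r)·H` with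
`H = tr(adj A·G) + (X − r)·tr(adj G·A) + (X − r)²·det G`. [folklore] -/
theorem det_pencil_split (d : Fin K → ℕ) (S : Fin K → Matrix (Fin 3) (Fin 3) ℝ) (r : ℝ)
    (hdet : (∑ l, r ^ d l • S l).det = 0) :
    (∑ l, ((X : ℝ[X]) ^ d l) • (S l).map C).det
      = (X - C r) * ((((∑ l, r ^ d l • S l).map C).adjugate
            * Matrix.of (fun i j => (((∑ l, ((X : ℝ[X]) ^ d l) • (S l).map C) i j - C ((∑ l, r ^ d l • S l) i j)) /ₘ (X - C r)))).trace
          + (X - C r) * ((Matrix.of (fun i j => (((∑ l, ((X : ℝ[X]) ^ d l) • (S l).map C) i j - C ((∑ l, r ^ d l • S l) i j)) /ₘ (X - C r)))).adjugate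
            * (∑ l, r ^ d l • S l).map C).trace
          + (X - C r) ^ 2 * (Matrix.of (fun i j => (((∑ l, ((X : ℝ[X]) ^ d l) • (S l).map C) i j - C ((∑ l, r ^ d l • S l) i j)) /ₘ (X - C r)))).det) := by
  conv_lhs => rw [pencil_split d S r]
  rw [det_add_smul_three]
  have hA : ((∑ l, r ^ d l • S l).map C).det = 0 := by
    have := RingHom.map_det (C : ℝ →+* ℝ[X]) (∑ l, r ^ d l • S l)
    rw [RingHom.mapMatrix_apply] at this
    rw [← this, hdet, map_zero]
  rw [hA]; ring

/-- Evaluating `H` at `r`: `H(r) = tr(adj A · G(r))`. [folklore] -/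
theorem eval_H (d : Fin K → ℕ) (S : Fin K → Matrix (Fin 3) (Fin 3) ℝ) (r : ℝ) :
    ((((∑ l, r ^ d l • S l).map C).adjugate
            * Matrix.of (fun i j => (((∑ l, ((X : ℝ[X]) ^ d l) • (S l).map C) i j - C ((∑ l, r ^ d l • S l) i j)) /ₘ (X - C r)))).trace
          + (X - C r) * ((Matrix.of (fun i j => (((∑ l, ((X : ℝ[X]) ^ d l) • (S l).map C) i j - C ((∑ l, r ^ d l • S l) i j)) /ₘ (X - C r)))).adjugate
            * (∑ l, r ^ d l • S l).map C).trace
          + (X - C r) ^ 2 * (Matrix.of (fun i j => (((∑ l, ((X : ℝ[X]) ^ d l) • (S l).map C) i j - C ((∑ l, r ^ d l • S l) i j)) /ₘ (X - C r)))).det).eval r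
      = ((∑ l, r ^ d l • S l).adjugate
          * (evalRingHom r).mapMatrix (Matrix.of (fun i j => (((∑ l, ((X : ℝ[X]) ^ d l) • (S l).map C) i j - C ((∑ l, r ^ d l • S l) i j)) /ₘ (X - C r))))).trace := by
  set G := Matrix.of (fun i j => (((∑ l, ((X : ℝ[X]) ^ d l) • (S l).map C) i j - C ((∑ l, r ^ d l • S l) i j)) /ₘ (X - C r))) with hG
  have ht : (X - C r).eval r = 0 := by simp
  rw [eval_add, eval_add, eval_mul, eval_mul, ht, zero_mul, add_zero, eval_pow, ht, zero_pow two_ne_zero, zero_mul, add_zero]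
  -- trace of product commutes with evaluation
  have key : ∀ M N : Matrix (Fin 3) (Fin 3) ℝ[X], (M * N).trace.eval r
      = ((evalRingHom r).mapMatrix M * (evalRingHom r).mapMatrix N).trace := by
    intro M N
    rw [← map_mul]
    simp only [Matrix.trace, Matrix.diag, RingHom.mapMatrix_apply, Matrix.map_apply, coe_evalRingHom, eval_finsetSum]
  rw [key]
  congr 2
  rw [RingHom.map_adjugate]
  congr 1
  ext i j
  simp [RingHom.mapMatrix_apply, Matrix.map_apply]

/-! ## 4. Simple root ⇒ `tr(adj A · G(r)) ≠ 0`; kernel ⇒ `kᵀ G(r) k ≠ 0` -/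

/-- **Simple det-root ⇒ the first-order trace term is non-zero.**  If `det P(r) = 0` and `(X − r)²` does NOT divide `det P`, then
`tr(adj P(r) · G(r)) ≠ 0`. [folklore] -/
theorem trace_adjugate_mul_ne_zero_of_simple (d : Fin K → ℕ) (S : Fin K → Matrix (Fin 3) (Fin 3) ℝ) (r : ℝ)
    (hdet : (∑ l, r ^ d l • S l).det = 0)
    (hsimple : ¬ (X - C r) ^ 2 ∣ (∑ l, ((X : ℝ[X]) ^ d l) • (S l).map C).det) :
    ((∑ l, r ^ d l • S l).adjugate
      * (evalRingHom r).mapMatrix (Matrix.of (fun i j => (((∑ l, ((X : ℝ[X]) ^ d l) • (S l).map C) i j - C ((∑ l, r ^ d l • S l) i j)) /ₘ (X - C r))))).trace ≠ 0 := by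
  intro h0
  apply hsimple
  rw [det_pencil_split d S r hdet]
  set H := (((∑ l, r ^ d l • S l).map C).adjugate
            * Matrix.of (fun i j => (((∑ l, ((X : ℝ[X]) ^ d l) • (S l).map C) i j - C ((∑ l, r ^ d l • S l) i j)) /ₘ (X - C r)))).trace
          + (X - C r) * ((Matrix.of (fun i j => (((∑ l, ((X : ℝ[X]) ^ d l) • (S l).map C) i j - C ((∑ l, r ^ d l • S l) i j)) /ₘ (X - C r)))).adjugate
            * (∑ l, r ^ d l • S l).map C).trace
          + (X - C r) ^ 2 * (Matrix.of (fun i j => (((∑ l, ((X : ℝ[X]) ^ d l) • (S l).map C) i j - C ((∑ l, r ^ d l • S l) i j)) /ₘ (X - C r)))).det with hH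
  have hHr : H.IsRoot r := by rw [IsRoot.def, hH, eval_H d S r]; exact h0
  obtain ⟨H', hH'⟩ := dvd_iff_isRoot.mpr hHr
  exact ⟨H', by rw [hH', pow_two, mul_assoc]⟩

/-- `tr (k kᵀ · M) = kᵀ M k`. [folklore] -/
theorem trace_vecMulVec_mul (k : Fin 3 → ℝ) (M : Matrix (Fin 3) (Fin 3) ℝ) :
    (Matrix.vecMulVec k k * M).trace = k ⬝ᵥ (M *ᵥ k) := by
  simp only [Matrix.trace, Matrix.diag, Matrix.mul_apply, Matrix.vecMulVec_apply, dotProduct, Matrix.mulVec, Fin.sum_univ_three]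
  ring

/-- **Kernel form.**  For symmetric `A` with `A k = 0`, `k ≠ 0`, `tr adj A ≠ 0` (rank two): `tr(adj A · M) ≠ 0 ⇒ kᵀ M k ≠ 0`
(`|k|²·adj A = tr(adj A)·kkᵀ`, `…KernelPlanes.adjugate_smul_eq_of_mulVec_eq_zero`). [folklore] -/
theorem quadForm_ne_zero_of_trace_adjugate_mul_ne_zero {A : Matrix (Fin 3) (Fin 3) ℝ} (hA : A.IsSymm) {k : Fin 3 → ℝ}
    (hk : A *ᵥ k = 0) (hk0 : k ≠ 0) (M : Matrix (Fin 3) (Fin 3) ℝ) (h : (A.adjugate * M).trace ≠ 0) :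
    k ⬝ᵥ (M *ᵥ k) ≠ 0 := by
  have hid := adjugate_smul_eq_of_mulVec_eq_zero hA hk
  have hkk : k ⬝ᵥ k ≠ 0 := fun h0 => hk0 (dotProduct_self_eq_zero.mp h0)
  have hmul := congrArg (fun X : Matrix (Fin 3) (Fin 3) ℝ => (X * M).trace) hid
  simp only [Matrix.smul_mul, Matrix.trace_smul, smul_eq_mul, trace_vecMulVec_mul] at hmul
  intro h0
  rw [h0, mul_zero] at hmul
  exact h (by rcases mul_eq_zero.mp hmul with h' | h' <;> [exact absurd h' hkk; exact h'])

/-! ## 5. The Rayleigh polynomial of the kernel has a SIMPLE root -/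

/-- Evaluation of the Rayleigh polynomial `Q_k = kᵀ P(X) k`. [folklore] -/
theorem eval_rayleigh (d : Fin K → ℕ) (S : Fin K → Matrix (Fin 3) (Fin 3) ℝ) (k : Fin 3 → ℝ) (x : ℝ) :
    ((fun i => C (k i)) ⬝ᵥ ((∑ l, ((X : ℝ[X]) ^ d l) • (S l).map C) *ᵥ (fun i => C (k i)))).eval x
      = k ⬝ᵥ ((∑ l, x ^ d l • S l) *ᵥ k) := by
  have h1 := RingHom.map_dotProduct (evalRingHom x) (fun i => C (k i)) ((∑ l, ((X : ℝ[X]) ^ d l) • (S l).map C) *ᵥ (fun i => C (k i)))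
  have h2 : (evalRingHom x) ∘ ((∑ l, ((X : ℝ[X]) ^ d l) • (S l).map C) *ᵥ fun i => C (k i))
      = ((evalRingHom x).mapMatrix (∑ l, ((X : ℝ[X]) ^ d l) • (S l).map C)) *ᵥ ((evalRingHom x) ∘ fun i => C (k i)) := by
    funext i; rw [Function.comp_apply, RingHom.map_mulVec, RingHom.mapMatrix_apply]
  have h3 : ((evalRingHom x) ∘ fun i => C (k i)) = k := by funext i; simp
  rw [h2, h3, mapMatrix_eval_pencil] at h1
  exact h1

/-- **TRANSVERSALITY (algebraic form).**  If `P(r)k = 0` then `kᵀ P(X) k = (X − r)·g` with `g(r) = kᵀ G(r) k`. [folklore] -/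
theorem rayleigh_split (d : Fin K → ℕ) (S : Fin K → Matrix (Fin 3) (Fin 3) ℝ) (r : ℝ) {k : Fin 3 → ℝ}
    (hk : (∑ l, r ^ d l • S l) *ᵥ k = 0) :
    ((fun i => C (k i)) ⬝ᵥ ((∑ l, ((X : ℝ[X]) ^ d l) • (S l).map C) *ᵥ (fun i => C (k i))))
      = (X - C r) * ((fun i => C (k i)) ⬝ᵥ ((Matrix.of (fun i j => (((∑ l, ((X : ℝ[X]) ^ d l) • (S l).map C) i j
          - C ((∑ l, r ^ d l • S l) i j)) /ₘ (X - C r)))) *ᵥ (fun i => C (k i)))) := by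
  conv_lhs => rw [pencil_split d S r]
  rw [Matrix.add_mulVec, Matrix.smul_mulVec, dotProduct_add, dotProduct_smul, smul_eq_mul]
  have h0 : ((∑ l, r ^ d l • S l).map C) *ᵥ (fun i => C (k i)) = 0 := by
    funext i
    have := RingHom.map_mulVec (C : ℝ →+* ℝ[X]) (∑ l, r ^ d l • S l) k i
    rw [show ((C : ℝ →+* ℝ[X]) ∘ k) = fun i => C (k i) from rfl] at this
    rw [← this, hk]; simp
  rw [h0, dotProduct_zero, zero_add]

/-- **TRANSVERSALITY LAW.**  Let `P(x) = ∑ x^{d l} S_l` be a real symmetric `3 × 3` lacunary pencil, `r` a det-root with kernel vector `k`,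
and suppose `r` is a SIMPLE root of `det P` (`(X − r)² ∤ det P`; this already forces `P(r)` to have rank two).  Then the Rayleigh
`K`-nomial `x ↦ kᵀP(x)k` CHANGES SIGN at `r`: there is `δ > 0` with `kᵀP(x)k · kᵀP(y)k < 0` whenever `r − δ < x < r < y < r + δ`.
(Jacobi's first-order expansion `det P = (X − r)·(tr(adj P(r)·G) + …)`, the kernel form of `adj P(r)`, and `kᵀP(X)k = (X − r)·kᵀG(X)k`.)
So a plane containing the kernel of a simple PSD det-root is INDEFINITE on the far side: the partner-zero mechanism of the pair-plane budget. [folklore] -/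
theorem rayleigh_sign_change (d : Fin K → ℕ) (S : Fin K → Matrix (Fin 3) (Fin 3) ℝ) (hS : ∀ l, (S l).IsSymm) (r : ℝ)
    {k : Fin 3 → ℝ} (hk0 : k ≠ 0) (hk : (∑ l, r ^ d l • S l) *ᵥ k = 0)
    (hsimple : ¬ (X - C r) ^ 2 ∣ (∑ l, ((X : ℝ[X]) ^ d l) • (S l).map C).det) :
    ∃ δ > 0, ∀ x y : ℝ, r - δ < x → x < r → r < y → y < r + δ →
      (k ⬝ᵥ ((∑ l, x ^ d l • S l) *ᵥ k)) * (k ⬝ᵥ ((∑ l, y ^ d l • S l) *ᵥ k)) < 0 := by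
  have hdet : (∑ l, r ^ d l • S l).det = 0 := (Matrix.exists_mulVec_eq_zero_iff).mp ⟨k, hk0, hk⟩
  set G := Matrix.of (fun i j => (((∑ l, ((X : ℝ[X]) ^ d l) • (S l).map C) i j - C ((∑ l, r ^ d l • S l) i j)) /ₘ (X - C r)))
    with hG
  set g : ℝ[X] := (fun i => C (k i)) ⬝ᵥ (G *ᵥ (fun i => C (k i))) with hg
  have htr := trace_adjugate_mul_ne_zero_of_simple d S r hdet hsimple
  have hq := quadForm_ne_zero_of_trace_adjugate_mul_ne_zero (isSymm_pencil_eval d hS r) hk hk0 _ htr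
  -- g(r) = kᵀ G(r) k
  have hgr : g.eval r = k ⬝ᵥ (((evalRingHom r).mapMatrix G) *ᵥ k) := by
    rw [hg]
    have h1 := RingHom.map_dotProduct (evalRingHom r) (fun i => C (k i)) (G *ᵥ (fun i => C (k i)))
    have h2 : (evalRingHom r) ∘ (G *ᵥ fun i => C (k i)) = ((evalRingHom r).mapMatrix G) *ᵥ ((evalRingHom r) ∘ fun i => C (k i)) := by
      funext i; rw [Function.comp_apply, RingHom.map_mulVec, RingHom.mapMatrix_apply]
    have h3 : ((evalRingHom r) ∘ fun i => C (k i)) = k := by funext i; simp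
    rw [h2, h3] at h1
    exact h1
  have hgr0 : g.eval r ≠ 0 := by rw [hgr]; exact hq
  -- the Rayleigh values: kᵀP(x)k = (x − r)·g(x)
  have hval : ∀ x : ℝ, k ⬝ᵥ ((∑ l, x ^ d l • S l) *ᵥ k) = (x - r) * g.eval x := by
    intro x
    rw [← eval_rayleigh d S k x, rayleigh_split d S r hk, eval_mul, eval_sub, eval_X, eval_C]
  -- continuity of g at r keeps its sign
  have hcont : ContinuousAt (fun x => g.eval x) r := g.continuous.continuousAt
  obtain ⟨δ, hδ, hball⟩ := Metric.continuousAt_iff.mp hcont |g.eval r| (abs_pos.mpr hgr0)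
  refine ⟨δ, hδ, fun x y hx1 hx2 hy1 hy2 => ?_⟩
  have hx : |g.eval x - g.eval r| < |g.eval r| := by
    have := hball (x := x) (by rw [Real.dist_eq, abs_lt]; constructor <;> linarith)
    rwa [Real.dist_eq] at this
  have hy : |g.eval y - g.eval r| < |g.eval r| := by
    have := hball (x := y) (by rw [Real.dist_eq, abs_lt]; constructor <;> linarith)
    rwa [Real.dist_eq] at this
  have hsame : 0 < g.eval x * g.eval y := by
    rcases lt_or_gt_of_ne hgr0 with hneg | hpos
    · rw [abs_of_neg hneg] at hx hy
      have hx' : g.eval x < 0 := by rw [abs_lt] at hx; linarith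
      have hy' : g.eval y < 0 := by rw [abs_lt] at hy; linarith
      exact mul_pos_of_neg_of_neg hx' hy'
    · rw [abs_of_pos hpos] at hx hy
      have hx' : 0 < g.eval x := by rw [abs_lt] at hx; linarith
      have hy' : 0 < g.eval y := by rw [abs_lt] at hy; linarith
      exact mul_pos hx' hy'
  rw [hval x, hval y]
  have : (x - r) * g.eval x * ((y - r) * g.eval y) = ((x - r) * (y - r)) * (g.eval x * g.eval y) := by ring
  rw [this]
  exact mul_neg_of_neg_of_pos (mul_neg_of_neg_of_pos (by linarith) (by linarith)) hsame

/-- **Corollary (the far side of a PSD-singular point is negative).**  Under the hypotheses of `rayleigh_sign_change`, if `kᵀP(y)k > 0`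
for all `y` in a right neighbourhood of `r` (e.g. `P(y) ≻ 0` there — a positivity window), then `kᵀP(x)k < 0` for all `x` in a left
neighbourhood of `r`: every plane through `k` carries a NEGATIVE Rayleigh vector just left of `r`. [folklore] -/
theorem rayleigh_neg_left_of_pos_right (d : Fin K → ℕ) (S : Fin K → Matrix (Fin 3) (Fin 3) ℝ) (hS : ∀ l, (S l).IsSymm) (r : ℝ)
    {k : Fin 3 → ℝ} (hk0 : k ≠ 0) (hk : (∑ l, r ^ d l • S l) *ᵥ k = 0)
    (hsimple : ¬ (X - C r) ^ 2 ∣ (∑ l, ((X : ℝ[X]) ^ d l) • (S l).map C).det)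
    {η : ℝ} (hη : 0 < η) (hpos : ∀ y : ℝ, r < y → y < r + η → 0 < k ⬝ᵥ ((∑ l, y ^ d l • S l) *ᵥ k)) :
    ∃ δ > 0, ∀ x : ℝ, r - δ < x → x < r → k ⬝ᵥ ((∑ l, x ^ d l • S l) *ᵥ k) < 0 := by
  obtain ⟨δ, hδ, hsc⟩ := rayleigh_sign_change d S hS r hk0 hk hsimple
  refine ⟨δ, hδ, fun x hx1 hx2 => ?_⟩
  set y := r + min δ η / 2 with hy
  have hy1 : r < y := by rw [hy]; linarith [lt_min hδ hη]
  have hy2 : y < r + δ := by rw [hy]; linarith [min_le_left δ η, lt_min hδ hη]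
  have hy3 : y < r + η := by rw [hy]; linarith [min_le_right δ η, lt_min hδ hη]
  have hprod := hsc x y hx1 hx2 hy1 hy2
  have hyp := hpos y hy1 hy3
  by_contra hcon
  push Not at hcon
  exact absurd hprod (not_lt.mpr (mul_nonneg hcon hyp.le))

/-- **Mirror corollary (the near side of a window's right end).**  Symmetrically: positivity on a LEFT neighbourhood gives negativity on a right one. [folklore] -/
theorem rayleigh_neg_right_of_pos_left (d : Fin K → ℕ) (S : Fin K → Matrix (Fin 3) (Fin 3) ℝ) (hS : ∀ l, (S l).IsSymm) (r : ℝ)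
    {k : Fin 3 → ℝ} (hk0 : k ≠ 0) (hk : (∑ l, r ^ d l • S l) *ᵥ k = 0)
    (hsimple : ¬ (X - C r) ^ 2 ∣ (∑ l, ((X : ℝ[X]) ^ d l) • (S l).map C).det)
    {η : ℝ} (hη : 0 < η) (hpos : ∀ x : ℝ, r - η < x → x < r → 0 < k ⬝ᵥ ((∑ l, x ^ d l • S l) *ᵥ k)) :
    ∃ δ > 0, ∀ y : ℝ, r < y → y < r + δ → k ⬝ᵥ ((∑ l, y ^ d l • S l) *ᵥ k) < 0 := by
  obtain ⟨δ, hδ, hsc⟩ := rayleigh_sign_change d S hS r hk0 hk hsimple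
  refine ⟨δ, hδ, fun y hy1 hy2 => ?_⟩
  set x := r - min δ η / 2 with hx
  have hx1 : r - δ < x := by rw [hx]; linarith [min_le_left δ η, lt_min hδ hη]
  have hx2 : x < r := by rw [hx]; linarith [lt_min hδ hη]
  have hx3 : r - η < x := by rw [hx]; linarith [min_le_right δ η, lt_min hδ hη]
  have hprod := hsc x y hx1 hx2 hy1 hy2
  have hxp := hpos x hx3 hx2
  by_contra hcon
  push Not at hcon
  have : 0 ≤ (k ⬝ᵥ ((∑ l, x ^ d l • S l) *ᵥ k)) * (k ⬝ᵥ ((∑ l, y ^ d l • S l) *ᵥ k)) := mul_nonneg hxp.le hcon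
  linarith

end Transversal

end Summit.ValiantsHypothesis.ValiantsHypothesis.Theorems.LacunarySymmetroidMatrixDescartes.Census
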